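import Summits.QuantumFields.BalabanUV.T4Continuum.Spine.NE9.DirectPairingApexDesign
import Literature.MathematicalPhysics.QuantumFieldTheory.Balaban1983to89.T4MatchingClosure

/-!
# T⁴ programme, spine estimate NE9 — KING'S CURRENCY THROUGH THE CELL'S RE-INDEXED TERM BUDGET: the named slot rates
# `r` (recent factors), `u`, `s₂` (NE-R1 two-run halves), `s` (recent deviation) need only TEND TO ZERO, n-uniformly, instead of being
# summable — census item C38d of cell `pub-balaban-gaps`, seat ne9 (gen 10)

Cell `pub-balaban-gaps` (YM blitz G2, seat ne9, unit `pub-balaban-gaps-ne9-g10`; record `run/shared/lean/pub/pub-balaban-gaps/ne/NE9.md`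
§5 row C38d).  Summits-side bookkeeping over the tree's node-U5 closure vocabulary (`T4MatchingClosure.ReindexedBudget`, `goodClause_of_reindexed`;
`T4GoodClassBudget.GoodClause`, `TermBudget`, `goodClause_of_termBudget`) and this seat's `DirectPairingApexDesign` (C38c).  NO definition; nothing
of Bałaban's asserted.

WHY.  C38c (`DirectPairingApexDesign`) consumed node U5's design (i) per pair (K, K + n) with the CORE clause as a hypothesis of width `vol·δ K`,
`δ → 0`.  In the cell's closure the core clause is PRODUCED, per cutoff `K` and with no summation over cutoffs, from the re-indexed per-term budget
`T4MatchingClosure.ReindexedBudget` (row T4-U5.E-b: per-term sandwich `e^{Cc ∓ Rr}`, UV constant `ν K` up to `vol·s₂ K`, UV radius `vol·u K`, recent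
radius `vol·r K`, recent deviation `vol·s K`) by `goodClause_of_reindexed` — `δ = (r + u) + (s + s₂)` — and ONLY THEN summed (`summable_reindexedDelta`:
`Summable r`, `u`, `s`, `s₂`, node U4′).  So in King's organisation the budget is consumed VERBATIM per pair and the four named rate profiles need only
tend to zero:
* §1 `tendsto_reindexedDelta`: `r, u, s, s₂ → 0 ⇒ (r + u) + (s + s₂) → 0` (compare `T4MatchingClosure.summable_reindexedDelta`).
* §2 `kingMatching_of_reindexedBudget` ∕ `cauchy_of_reindexedBudget`: per pair (K, K + n) NE7b's `RelWeightBound`, NE7c's `ShellWeightBound`, `W + Wsh < 1`,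
  the dictionary with positive totals, and a `ReindexedBudget` for the CORES with rate profiles `r, u, s, s₂` INDEPENDENT of `n` (the class constant `c₀ n K`
  and the UV constant `ν n K` may depend on the pair — they are absorbed in King's constant `c_{K,n}`) ⇒ King's matching with remainder
  `vol·hybridDelta vol ((r+u)+(s+s₂)) (W + Wsh) K`, and with `r, u, s, s₂ → 0` every generating function is Cauchy with uniform convergence on the `l₀`-ball
  (`goodClause_of_reindexed` + `DirectPairingApexDesign.kingMatching_of_design` ∕ `cauchy_of_design` BY NAME); `kingMatching_of_termBudget`: the same
  from the plain `T4GoodClassBudget.TermBudget` (`δ = r + s`).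

VERDICT FOR THE ROW (census C38d): in King's organisation the cell's node-U5 closure is consumed down to its re-indexed term budget with ONE change — the
four named rate profiles `r` (recent factors: crossover ∕ window sums ∕ boundary group), `u`, `s₂` (NE-R1 two-run UV halves), `s` (recent deviation) are asked
to TEND TO ZERO n-uniformly instead of being SUMMABLE over the cutoffs.  On the E-side this is exactly where NE9 sat: the history bracket enters the
recent radius `r K`; in King's currency it is the direct bracket `b_j → 0` of `DirectPairing.directBracket_eventually_le` (§17 rows 1–5 of `NE9.md`), no
`FadingMemory`, no modulus.  HONEST RESIDUE: the per-pair PRODUCERS of the budget for runs `n` apart (`T4MatchingClosureFed` ∕ `TwoRun` ∕ `Rem` restated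
n-uniformly; owner T4-DAG); instance 0∕1.  CLASSIFICATION OF NE9 UNCHANGED: WORK-bound (W1).

HONEST FRAMING: bookkeeping for rung (B)+1 on ONE FIXED finite four-torus; every clause is a hypothesis SHAPE (NE7, NE7b, NE7c, NE-R1 — the cell's located
new estimates, none in print for Bałaban's d = 4 procedure); NE9 NOT PRINTED ∕ NOT PROVED; spine PROVED 0∕9 unchanged; NOT UV stability, NOT the continuum
limit, NOT infinite volume, NOT a mass gap, NOT Clay.  HONEST DEPENDENCY: continuum YM on T⁴ ⇐ BetaPertH ∧ nine spine estimates (0∕9 proved); BetaPertH ⇐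
(D1) ∧ (D4) ∧ CAP+tail.

References (TYPES only): [King1986] = C. King, Commun. Math. Phys. **102** (1986) 649–677, Thm 3.4 (3.9) p. 656, (3.10)–(3.13) pp. 656–657.
-/

namespace Summit.QuantumFields.BalabanUV.T4Continuum.NE9.DirectPairingApexBudget

open scoped BigOperators
open Finset Filter Topology
open Literature.MathematicalPhysics.QuantumFieldTheory.Balaban1983to89
open T4CauchySum (genFun genFunLim)
open T4HybridMatching (hybridDelta)
open T4WeightBudget (RelWeightBound)
open T4IndicatorShell (ShellWeightBound)
open T4GoodClassBudget (GoodClause TermBudget goodClause_of_termBudget)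
open T4MatchingClosure (ReindexedBudget goodClause_of_reindexed)
open Summit.QuantumFields.BalabanUV.T4Continuum.NE9.DirectPairingApexDesign (kingMatching_of_design cauchy_of_design)

/-! ## §1 The re-indexed remainder rate tends to zero from its four named pieces -/

/-- `r, u, s, s₂ → 0 ⇒ (r + u) + (s + s₂) → 0` — the c₀ companion of `T4MatchingClosure.summable_reindexedDelta`. [folklore] -/
theorem tendsto_reindexedDelta {r u s s₂ : ℕ → ℝ} (hr : Tendsto r atTop (𝓝 0)) (hu : Tendsto u atTop (𝓝 0))
    (hs : Tendsto s atTop (𝓝 0)) (hs₂ : Tendsto s₂ atTop (𝓝 0)) :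
    Tendsto (fun K => (r K + u K) + (s K + s₂ K)) atTop (𝓝 0) := by
  simpa using (hr.add hu).add (hs.add hs₂)

/-! ## §2 The re-indexed term budget per pair (K, K + n) ⇒ King's matching ⇒ node U6 -/

section Pair

variable {ι : Type*} [DecidableEq ι] {l₀ vol : ℝ} {W Wsh r u s s₂ : ℕ → ℝ} {Z : ℕ → ℝ → ℝ}

/-- **KING'S MATCHING FROM THE RE-INDEXED TERM BUDGET, PER PAIR.**  For every `n`: NE7b's `RelWeightBound`, NE7c's `ShellWeightBound` (weights independent
of `n`), `W K + Wsh K < 1`, the dictionary `Z K = Σ A n K`, `Z (K + n) = Σ B n K` on `|t| ≤ l₀` with positive totals, and a `T4MatchingClosure.ReindexedBudget`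
for the CORES `A n − shA n`, `B n − shB n` with rate profiles `r, u, s, s₂` INDEPENDENT of `n` (class constant `c₀ n`, UV constant `ν n` free per pair).  Then
`|log Z_{K+n}(t) − log Z_K(t) − c_{K,n}| ≤ vol·hybridDelta vol ((r+u)+(s+s₂)) (W + Wsh) K` for all `K`, `n` — `goodClause_of_reindexed` (per pair, no
summation over cutoffs) into `DirectPairingApexDesign.kingMatching_of_design`, BY NAME. [cite: King1986, Thm 3.4 (3.9) p. 656] [folklore] -/
theorem kingMatching_of_reindexedBudget (hvol : 0 < vol) (T : ℕ → ℕ → Finset ι) (A B shA shB : ℕ → ℕ → ℝ → ι → ℝ)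
    (Bad : ℕ → ℕ → ℝ → Finset ι) (Cc Rr CcRec RrRec : ℕ → ℕ → ℝ → ι → ℝ) (ν c₀ : ℕ → ℕ → ℝ)
    (hW : ∀ n, RelWeightBound l₀ (T n) (A n) (B n) (Bad n) W)
    (hSh : ∀ n, ShellWeightBound l₀ (T n) (A n) (B n) (shA n) (shB n) Wsh) (hlt : ∀ K, W K + Wsh K < 1)
    (hZA : ∀ n K t, |t| ≤ l₀ → Z K t = ∑ τ ∈ T n K, A n K t τ)
    (hZB : ∀ n K t, |t| ≤ l₀ → Z (K + n) t = ∑ τ ∈ T n K, B n K t τ)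
    (hpos : ∀ n K t, |t| ≤ l₀ → 0 < ∑ τ ∈ T n K, A n K t τ)
    (hRB : ∀ n, ReindexedBudget l₀ vol (T n) (fun K t τ => A n K t τ - shA n K t τ) (fun K t τ => B n K t τ - shB n K t τ)
      (Bad n) (Cc n) (Rr n) (CcRec n) (RrRec n) (ν n) u s₂ (c₀ n) r s) :
    ∀ K n : ℕ, ∃ c : ℝ, ∀ t : ℝ, |t| ≤ l₀ →
      |Real.log (Z (K + n) t) - Real.log (Z K t) - c| ≤
        vol * hybridDelta vol (fun K => (r K + u K) + (s K + s₂ K)) (fun K => W K + Wsh K) K :=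
  kingMatching_of_design hvol T A B shA shB Bad hW hSh hlt hZA hZB hpos fun n K => (goodClause_of_reindexed (hRB n)) K

/-- **NODE U6 FROM THE RE-INDEXED BUDGET IN KING'S ORGANISATION — the four named rates `r, u, s, s₂` TEND TO ZERO, nothing is summed over the
cutoffs.**  Under the hypotheses of `kingMatching_of_reindexedBudget`, `0 ≤ l₀` and `r, u, s, s₂ → 0`: every generating function `K ↦ genFun Z K t`,
`|t| ≤ l₀`, is Cauchy with uniform convergence on the closed `l₀`-ball.  Compare the consecutive closure `T4MatchingClosure.hybridNE7_closure` +
`summable_reindexedDelta` (`Summable r, u, s, s₂`). [cite: King1986, p. 657] [folklore] -/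
theorem cauchy_of_reindexedBudget (hvol : 0 < vol) (hl₀ : 0 ≤ l₀) (T : ℕ → ℕ → Finset ι) (A B shA shB : ℕ → ℕ → ℝ → ι → ℝ)
    (Bad : ℕ → ℕ → ℝ → Finset ι) (Cc Rr CcRec RrRec : ℕ → ℕ → ℝ → ι → ℝ) (ν c₀ : ℕ → ℕ → ℝ)
    (hW : ∀ n, RelWeightBound l₀ (T n) (A n) (B n) (Bad n) W)
    (hSh : ∀ n, ShellWeightBound l₀ (T n) (A n) (B n) (shA n) (shB n) Wsh) (hlt : ∀ K, W K + Wsh K < 1)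
    (hZA : ∀ n K t, |t| ≤ l₀ → Z K t = ∑ τ ∈ T n K, A n K t τ)
    (hZB : ∀ n K t, |t| ≤ l₀ → Z (K + n) t = ∑ τ ∈ T n K, B n K t τ)
    (hpos : ∀ n K t, |t| ≤ l₀ → 0 < ∑ τ ∈ T n K, A n K t τ)
    (hRB : ∀ n, ReindexedBudget l₀ vol (T n) (fun K t τ => A n K t τ - shA n K t τ) (fun K t τ => B n K t τ - shB n K t τ)
      (Bad n) (Cc n) (Rr n) (CcRec n) (RrRec n) (ν n) u s₂ (c₀ n) r s)
    (hr : Tendsto r atTop (𝓝 0)) (hu : Tendsto u atTop (𝓝 0)) (hs : Tendsto s atTop (𝓝 0))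
    (hs₂ : Tendsto s₂ atTop (𝓝 0)) :
    (∀ t : ℝ, |t| ≤ l₀ → CauchySeq fun K => genFun Z K t) ∧
      TendstoUniformlyOn (fun K t => genFun Z K t) (genFunLim Z) atTop {t | |t| ≤ l₀} :=
  cauchy_of_design hvol hl₀ T A B shA shB Bad hW hSh hlt hZA hZB hpos (tendsto_reindexedDelta hr hu hs hs₂)
    fun n K => (goodClause_of_reindexed (hRB n)) K

/-- **… and from the PLAIN per-term budget** (`T4GoodClassBudget.TermBudget` for the cores, `δ = r + s`, row T4-U5.E-b without the NE-R1 re-indexing):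
per pair, with `r, s` independent of `n` ⇒ King's matching with remainder `vol·hybridDelta vol (r + s) (W + Wsh) K` (`goodClause_of_termBudget`).
[folklore] -/
theorem kingMatching_of_termBudget (hvol : 0 < vol) (T : ℕ → ℕ → Finset ι) (A B shA shB : ℕ → ℕ → ℝ → ι → ℝ)
    (Bad : ℕ → ℕ → ℝ → Finset ι) (Cc Rr : ℕ → ℕ → ℝ → ι → ℝ) (c₀ : ℕ → ℕ → ℝ)
    (hW : ∀ n, RelWeightBound l₀ (T n) (A n) (B n) (Bad n) W)
    (hSh : ∀ n, ShellWeightBound l₀ (T n) (A n) (B n) (shA n) (shB n) Wsh) (hlt : ∀ K, W K + Wsh K < 1)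
    (hZA : ∀ n K t, |t| ≤ l₀ → Z K t = ∑ τ ∈ T n K, A n K t τ)
    (hZB : ∀ n K t, |t| ≤ l₀ → Z (K + n) t = ∑ τ ∈ T n K, B n K t τ)
    (hpos : ∀ n K t, |t| ≤ l₀ → 0 < ∑ τ ∈ T n K, A n K t τ)
    (hTB : ∀ n, TermBudget l₀ vol (T n) (fun K t τ => A n K t τ - shA n K t τ) (fun K t τ => B n K t τ - shB n K t τ)
      (Bad n) (Cc n) (Rr n) (c₀ n) r s) :
    ∀ K n : ℕ, ∃ c : ℝ, ∀ t : ℝ, |t| ≤ l₀ →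
      |Real.log (Z (K + n) t) - Real.log (Z K t) - c| ≤ vol * hybridDelta vol (fun K => r K + s K) (fun K => W K + Wsh K) K :=
  kingMatching_of_design hvol T A B shA shB Bad hW hSh hlt hZA hZB hpos fun n K => (goodClause_of_termBudget (hTB n)) K

end Pair

end Summit.QuantumFields.BalabanUV.T4Continuum.NE9.DirectPairingApexBudget
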